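/-
Copyright (c) 2026 the pub-hodgecm-mathlib formalisation cell (harness21).  Prover seat hodgecm-mathlib-K2Liu-p13 (g2), Track B «K2-LIT»,
#184♮ = hLiu418 = `stmt-HodgeConjecture-24832`; Road I v3 organ U1-CT-ind STAGE 2 (Q2), file F5-q — THE CAPSTONE OF THE TERM-2 CHAIN (★ F5-e∕h∕i∕k∕l∕m∕n∕o∕p wired).
-/
import Summits.HodgeConjecture.HodgeConjecture.Theorems.K2LiuKlingenInnerSectionBorelInvariant  -- ★∕📤 F5-p (+ ★ F5-n, F5-o, F5-c, F5-f, F5-i, #10a)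
import Summits.HodgeConjecture.HodgeConjecture.Theorems.K2LiuCoveringWeightFibreIntegration    -- ★ F5-e: `klingenInner_eq_mul_integral_fibre`
import Summits.HodgeConjecture.HodgeConjecture.Theorems.K2LiuHeisenbergProductHaar             -- ★ F5-k: `exists_haar_eq_map_klingenChart`, `klingenChart_eq_uPlus_mul`
import Summits.HodgeConjecture.HodgeConjecture.Theorems.K2LiuKlingenFibreMassConstant          -- ★ F5-l: `lintegral_fibre_klingenChart_eq_of_weight`
import Summits.HodgeConjecture.HodgeConjecture.Theorems.K2LiuKlingenStabiliserLattice          -- ★ F5-m: `stab_membership_law`, `countable_range_algebraMap`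
import HarnessLib

/-!
# Crux `HLiu418`, Road I v3, organ U1 stage 2 (Q2), file F5-q: CAPSTONE — THE INNER SECTION OF THE `ξ`-CELL (orbit form of ★ F5-a∕F5-g) IS
# `C · ∫ f(Ψ(ξ)·Ψ(n_Q(y,0,t))·x) d(μ_Y × μ_T)` AND IS LEFT-`B₂(L⁺)`-INVARIANT; TERM 2 OF `E_Q` IS AUTOMORPHIC ON THE KLINGEN LEVI

Cell `hodgecm-mathlib`, crux item hLiu418 = `stmt-HodgeConjecture-24832`; squad K2 ∕ K2Liu; LEAD F0P6-plan (g14), co-dealer K2E5-plan (g7); prover K2Liu-p13 (g2).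
THEOREMS ONLY (no `def`, no instance, no notation, no named-fact hypothesis, no `sorry`); lane `--supports stmt-HodgeConjecture-24832 --as helper` (count-neutral).
WIRING of the (Q2) term-2 chain, every former measure binder now DISCHARGED from structural data: `νN` a Haar measure on `N_Q(𝔸)`, additive Haar measures `μ_Z, μ_T` on `𝔸_L` and
`μ_Y` on the skew part `Y` (`hY`), the stabiliser lattice `Γ₁` of ★ F5-a (`hΓ₁`, its letter) with a `Γ₁`-covering weight `β₁`, ONE measurable `ι(L)`-covering weight `β₀` on `𝔸_L` of
finite mass (`L\𝔸_L` compact), `f` a continuous Siegel section, and the integrability of the orbit integrand (`hint`, ★ F4-2b under (H)):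
* **`exists_const_innerSectionOrbit_eq`**: `∃ C ≠ ∞, ∀ x, ∫ β₁(u) • f(Ψ(ξ) u x) dνN = C · ∫ f(Ψ(ξ) Ψ(n_Q(y,0,t)) x) d(μ_Y × μ_T)` (★ F5-e with `hνN` ← ★ F5-k, `hΦ`∕`hΦval` ← ★ F5-i∕k,
  `hfib` ← ★ F5-l∕m);
* **`innerSectionOrbit_borelU_mul`**: `∫ β₁ • f(Ψ(ξ) u Ψ(toAdelic m_Q(1,b)) x) dνN = ∫ β₁ • f(Ψ(ξ) u x) dνN` for rational upper-triangular `b` (+ ★ F5-p);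
* **`eisensteinSeriesU_innerSection_rational_mul`**: for the section `F_h(y) = ∫ β₁ • f(Ψ(toAdelic ξ) u Ψ(m_Q(1, j₂⁻¹y)) h) dνN` of ★ F5-g (`toAdelic ξ^L = jAdelic ξ^𝔸`, ★ F5-p):
  `eisensteinSeriesU F_h (toAdelic γ · g₂) = eisensteinSeriesU F_h g₂` for every `γ ∈ U(J₂)(L⁺)` (★ E1 `eisensteinSeriesU_rational_mul`) — TERM 2 OF `E_Q` IS AUTOMORPHIC ON THE
  KLINGEN LEVI, the (T3)-type input for `T₂` of ★ G0 `K2LiuKlingenConstantTermFamilyClauses` (symmetric to ★ F5-j for `T₁`).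
[MoeglinWaldspurger1995, II.1.5, II.1.7], [GanTakeda2011SiegelWeil, §7.2 p. 23], [WeilBNT1967, Ch. IV §4], [Garrett2018, §3.10].
HONEST LABEL.  Count-neutral helper: `HC_CM` is proved only modulo the 7 printed citations (2 remaining named inputs: hLiu418 = `stmt-HodgeConjecture-24832`,
h413 = `stmt-HodgeConjecture-24833`) until rung 0 closes.
-/

set_option autoImplicit false
set_option linter.dupNamespace false -- the mandated namespace repeats `HodgeConjecture.HodgeConjecture`

noncomputable section

open scoped Matrix ENNReal NNReal
open NumberField IsDedekindDomain MeasureTheory MeasureTheory.Measure Function MulAction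

namespace Summit.HodgeConjecture.HodgeConjecture.Cruxes.HLiu418.K2LiuKlingenInnerSectionAutomorphy

open Literature.MeasureTheory.Group
open Literature.NumberTheory.Automorphic Literature.NumberTheory.Automorphic.UnitaryGroup
open Literature.NumberTheory.GelbartRogawski1991 Literature.NumberTheory.GelbartRogawski1991.GRConstruction
open Literature.NumberTheory.GaloisRepresentations
open Literature.NumberTheory.K2Lit.SiegelDoubled
open Summit.HodgeConjecture.HodgeConjecture.Cruxes.HLiu418.K2LiuDoubledUTwoTwoBorelFrame
open Summit.HodgeConjecture.HodgeConjecture.Cruxes.HLiu418.K2LiuKlingenParabolicDefs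
open Summit.HodgeConjecture.HodgeConjecture.Cruxes.HLiu418.K2LiuKlingenUnipotentDefs
open Summit.HodgeConjecture.HodgeConjecture.Cruxes.HLiu418.K2LiuKlingenUnipotentAdelicDefs
open Summit.HodgeConjecture.HodgeConjecture.Cruxes.HLiu418.K2LiuKlingenUnipotentAdelicChart
open Summit.HodgeConjecture.HodgeConjecture.Cruxes.HLiu418.K2LiuKlingenRationalCells (complexConj_ringHom_apply_apply)
open Summit.HodgeConjecture.HodgeConjecture.Cruxes.HLiu418.K2LiuCoveringWeightFibreIntegration (klingenInner_eq_mul_integral_fibre)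
open Summit.HodgeConjecture.HodgeConjecture.Cruxes.HLiu418.K2LiuHeisenbergProductHaar (exists_haar_eq_map_klingenChart klingenChart_eq_uPlus_mul)
open Summit.HodgeConjecture.HodgeConjecture.Cruxes.HLiu418.K2LiuKlingenFibreMassConstant (lintegral_fibre_klingenChart_eq_of_weight)
open Summit.HodgeConjecture.HodgeConjecture.Cruxes.HLiu418.K2LiuKlingenStabiliserLattice (stab_membership_law countable_range_algebraMap)
open Summit.HodgeConjecture.HodgeConjecture.Cruxes.HLiu418.K2LiuKlingenInnerSectionBorelInvariant (toAdelic_weylXi_eq_jAdelic klingenInner_borelU_mul)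
open Summit.HodgeConjecture.HodgeConjecture.Cruxes.HLiu418.K2LiuKlingenCellOneEisensteinU (klingenLevi_one_mul jAdelic_klingenLevi_one_symm_toAdelic)
open Summit.HodgeConjecture.HodgeConjecture.Cruxes.HLiu418.K2LiuSiegelDoubledLeviMatrix (conjAdele_conjAdele')
open Summit.HodgeConjecture.HodgeConjecture.Cruxes.H413.K2E1BorelEisensteinU (eisensteinSeriesU eisensteinSeriesU_rational_mul)
open UnitaryDualPair

variable {L : Type} [Field L] [NumberField L] [IsCMField L]
variable {N M : ℕ} {e : Fin N × Fin M ≃ Fin 2}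
  {dV : Fin N → L} {hdV : ∀ i, IsCMField.complexConj L (dV i) = dV i}
  {dW : Fin M → L} {hdW : ∀ i, IsCMField.complexConj L (dW i) = dW i}

section Transport

variable {SA : GL (Fin (2 + 2)) (AdeleRing (𝓞 L) L)}
  {Ψ : (quasiSplit (Fp L) L (IsCMField.complexConj L) (2 + 2)).Adelic ≃ₜ* HA L e dV hdV dW hdW} {X Y : Matrix (Fin 2) (Fin 2) (Fp L)} {a : Fp L}
  (hΨ : ∀ g : (quasiSplit (Fp L) L (IsCMField.complexConj L) (2 + 2)).Adelic,
    (((Ψ g : HA L e dV hdV dW hdW) : GL (Fin (2 + 2)) (AdeleRing (𝓞 L) L)) : Matrix (Fin (2 + 2)) (Fin (2 + 2)) (AdeleRing (𝓞 L) L)) =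
      (SA : Matrix (Fin (2 + 2)) (Fin (2 + 2)) (AdeleRing (𝓞 L) L)) *
        ((adelicVal (Fp L) L (IsCMField.complexConj L) (2 + 2) _ g : GL (Fin (2 + 2)) (AdeleRing (𝓞 L) L)) :
          Matrix (Fin (2 + 2)) (Fin (2 + 2)) (AdeleRing (𝓞 L) L)) *
        ((SA⁻¹ : GL (Fin (2 + 2)) (AdeleRing (𝓞 L) L)) : Matrix (Fin (2 + 2)) (Fin (2 + 2)) (AdeleRing (𝓞 L) L)))
  (ha : a + a = 1)
  (hSA : Matrix.reindex (e₂ (n := 2)).symm (e₂ (n := 2)).symm (SA : Matrix (Fin (2 + 2)) (Fin (2 + 2)) (AdeleRing (𝓞 L) L)) =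
    Matrix.fromBlocks (1 : Matrix (Fin 2) (Fin 2) (AdeleRing (𝓞 L) L)) (X.map ((algebraMap L (AdeleRing (𝓞 L) L)).comp (algebraMap (Fp L) L))) 1
      (-(X.map ((algebraMap L (AdeleRing (𝓞 L) L)).comp (algebraMap (Fp L) L)))))
  (hSAi : Matrix.reindex (e₂ (n := 2)).symm (e₂ (n := 2)).symm ((SA⁻¹ : GL (Fin (2 + 2)) (AdeleRing (𝓞 L) L)) : Matrix (Fin (2 + 2)) (Fin (2 + 2)) (AdeleRing (𝓞 L) L)) =
    Matrix.fromBlocks ((a • (1 : Matrix (Fin 2) (Fin 2) (Fp L))).map ((algebraMap L (AdeleRing (𝓞 L) L)).comp (algebraMap (Fp L) L)))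
      ((a • (1 : Matrix (Fin 2) (Fin 2) (Fp L))).map ((algebraMap L (AdeleRing (𝓞 L) L)).comp (algebraMap (Fp L) L)))
      (Y.map ((algebraMap L (AdeleRing (𝓞 L) L)).comp (algebraMap (Fp L) L)))
      (-(Y.map ((algebraMap L (AdeleRing (𝓞 L) L)).comp (algebraMap (Fp L) L)))))
  (hXY : X * Y = a • (1 : Matrix (Fin 2) (Fin 2) (Fp L))) (hYX : Y * X = a • (1 : Matrix (Fin 2) (Fin 2) (Fp L)))
  (hΨP : ∀ b : (quasiSplit (Fp L) L (IsCMField.complexConj L) (2 + 2)).Adelic,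
    ((adelicVal (Fp L) L (IsCMField.complexConj L) (2 + 2) _ b : GL (Fin (2 + 2)) (AdeleRing (𝓞 L) L)) :
        Matrix (Fin (2 + 2)) (Fin (2 + 2)) (AdeleRing (𝓞 L) L)).BlockTriangular id →
      IsSiegelDelta L e dV hdV dW hdW (Ψ b))

include hΨ ha hSA hSAi hΨP hXY hYX in
/-- **THE ORBIT INTEGRAL OF THE `ξ`-CELL IS `C ·` THE POST-`u₊`-INTEGRATION SECTION** (★ F5-e, all its binders discharged: `hνN` ← ★ F5-k, `hΦval` ← ★ F5-k, `hfib` ← ★ F5-l∕m).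
[cite: MoeglinWaldspurger1995, II.1.7] [cite: GanTakeda2011SiegelWeil, §7.2 p. 23] -/
theorem exists_const_innerSectionOrbit_eq [MeasurableSpace (AdeleRing (𝓞 L) L)] [BorelSpace (AdeleRing (𝓞 L) L)] [SecondCountableTopology (AdeleRing (𝓞 L) L)]
    [MeasurableSpace ↥(klingenUnipA Ψ)] [BorelSpace ↥(klingenUnipA Ψ)] [LocallyCompactSpace ↥(klingenUnipA Ψ)] [SecondCountableTopology ↥(klingenUnipA Ψ)]
    (νN : Measure ↥(klingenUnipA Ψ)) [νN.IsHaarMeasure]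
    (Y : AddSubgroup (AdeleRing (𝓞 L) L)) (hY : ∀ y, y ∈ Y ↔ conjAdele (Fp L) L (IsCMField.complexConj L) y = -y)
    (μZ : Measure (AdeleRing (𝓞 L) L)) (μY : Measure ↥Y) (μT : Measure (AdeleRing (𝓞 L) L)) [SFinite μZ] [SFinite μY] [SFinite μT]
    [μZ.IsAddHaarMeasure] [μY.IsAddHaarMeasure] [μT.IsAddHaarMeasure]
    (Γ₁ : Subgroup ↥(klingenUnipA Ψ))
    (hΓ₁ : ∀ u : ↥(klingenUnipA Ψ), u ∈ Γ₁ ↔ (u : HA L e dV hdV dW hdW) ∈ ratH L e dV hdV dW hdW ∧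
      IsSiegelDelta L e dV hdV dW hdW (Ψ (UnitaryGroup.toAdelic (Fp L) L (IsCMField.complexConj L) (2 + 2) ((StdForm.antidiagonal (2 + 2)).over L) (weylXi L ((IsCMField.complexConj L : L ≃ₐ[Fp L] L) : L →+* L))) * (u : HA L e dV hdV dW hdW) * (Ψ (UnitaryGroup.toAdelic (Fp L) L (IsCMField.complexConj L) (2 + 2) ((StdForm.antidiagonal (2 + 2)).over L) (weylXi L ((IsCMField.complexConj L : L ≃ₐ[Fp L] L) : L →+* L))))⁻¹))
    {β₁ : ↥(klingenUnipA Ψ) → ℝ≥0∞} (hβ₁ : IsCoveringWeight ↥Γ₁ β₁)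
    {β₀ : AdeleRing (𝓞 L) L → ℝ≥0∞} (hβ₀m : Measurable β₀) (hβ₀ : ∀ z, ∑' l : ↥((algebraMap L (AdeleRing (𝓞 L) L)).toAddMonoidHom.range), β₀ ((l : AdeleRing (𝓞 L) L) + z) = 1)
    (hβ₀fin : ∫⁻ z, β₀ z ∂μZ ≠ ∞)
    {χ : HeckeCharacter L} {s : ℂ} {f : HA L e dV hdV dW hdW → ℂ} (hf : IsSiegelDeltaSection L e dV hdV dW hdW χ s f) (hfc : Continuous f)
    (hint : ∀ x : HA L e dV hdV dW hdW, Integrable (fun u : ↥(klingenUnipA Ψ) => (β₁ u).toReal • f (Ψ (jAdelic L 4 (weylXi (AdeleRing (𝓞 L) L) (conjAdele (Fp L) L (IsCMField.complexConj L)))) * (u : HA L e dV hdV dW hdW) * x)) νN) :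
    ∃ C : ℝ≥0∞, C ≠ ∞ ∧ ∀ x : HA L e dV hdV dW hdW, (∫ u, (β₁ u).toReal • f (Ψ (jAdelic L 4 (weylXi (AdeleRing (𝓞 L) L) (conjAdele (Fp L) L (IsCMField.complexConj L)))) * (u : HA L e dV hdV dW hdW) * (x)) ∂νN) = C.toReal * (∫ q : ↥Y × AdeleRing (𝓞 L) L, f (Ψ (jAdelic L 4 (weylXi (AdeleRing (𝓞 L) L) (conjAdele (Fp L) L (IsCMField.complexConj L)))) * Ψ (jAdelic L 4 (nKlingen (AdeleRing (𝓞 L) L) (conjAdele (Fp L) L (IsCMField.complexConj L)) (conjAdele_conjAdele' L) (((q.1 : ↥Y) : AdeleRing (𝓞 L) L)) ((hY _).1 q.1.2) 0 (q.2))) * (x)) ∂(μY.prod μT)) := by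
  haveI : Countable ↥((algebraMap L (AdeleRing (𝓞 L) L)).toAddMonoidHom.range) := countable_range_algebraMap (L := L)
  -- the product structure of `νN` (★ F5-k)
  obtain ⟨c, hc0, hctop, hνN⟩ := exists_haar_eq_map_klingenChart hΨ νN Y hY μZ μY μT
  -- the fibre mass (★ F5-l with ★ F5-m's membership law), for the left-invariant measure `c • μZ`
  have hΓΛ := stab_membership_law hΨ ha hSA hSAi hXY hYX Γ₁ hΓ₁
  have hfib : ∀ p : ↥Y × AdeleRing (𝓞 L) L, ∫⁻ z, β₁ ((fun p : AdeleRing (𝓞 L) L × (↥Y × AdeleRing (𝓞 L) L) =>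
        (⟨Ψ (jAdelic L 4 (nKlingen (AdeleRing (𝓞 L) L) (conjAdele (Fp L) L (IsCMField.complexConj L)) (conjAdele_conjAdele' L)
            (p.2.1 : AdeleRing (𝓞 L) L) ((hY _).1 p.2.1.2) p.1 p.2.2)), transport_nKlingen_mem Ψ _ _ _ _⟩ : ↥(klingenUnipA Ψ))) (z, p)) ∂(c • μZ) = ∫⁻ z, β₀ z ∂(c • μZ) := fun p =>
    lintegral_fibre_klingenChart_eq_of_weight hΨ Y hY _ Γ₁ hΓΛ hβ₁ (c • μZ) hβ₀m hβ₀ p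
  have hCtop : ∫⁻ z, β₀ z ∂(c • μZ) ≠ ∞ := by
    rw [lintegral_smul_measure]; exact ENNReal.mul_ne_top hctop hβ₀fin
  refine ⟨∫⁻ z, β₀ z ∂(c • μZ), hCtop, fun x => ?_⟩
  exact klingenInner_eq_mul_integral_fibre hΨ ha hSA hSAi hΨP νN (c • μZ) (μY.prod μT) (fun z : AdeleRing (𝓞 L) L => z)
    (fun q : ↥Y × AdeleRing (𝓞 L) L => ((q.1 : ↥Y) : AdeleRing (𝓞 L) L)) (fun q => (hY _).1 q.1.2) (fun q : ↥Y × AdeleRing (𝓞 L) L => q.2)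
    (fun p : AdeleRing (𝓞 L) L × (↥Y × AdeleRing (𝓞 L) L) =>
        (⟨Ψ (jAdelic L 4 (nKlingen (AdeleRing (𝓞 L) L) (conjAdele (Fp L) L (IsCMField.complexConj L)) (conjAdele_conjAdele' L)
            (p.2.1 : AdeleRing (𝓞 L) L) ((hY _).1 p.2.1.2) p.1 p.2.2)), transport_nKlingen_mem Ψ _ _ _ _⟩ : ↥(klingenUnipA Ψ))) (continuous_klingenChart Ψ hΨ Y hY).measurable (fun zp => klingenChart_eq_uPlus_mul Ψ Y hY zp) hνN hβ₁.1 hCtop hfib hf hfc x (hint x)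

include hΨ ha hSA hSAi hΨP hXY hYX in
/-- **THE ORBIT INTEGRAL IS LEFT-`B₂(L⁺)`-INVARIANT**: `∫ β₁ • f(Ψ(ξ) u Ψ(toAdelic m_Q(1,b)) x) dνN = ∫ β₁ • f(Ψ(ξ) u x) dνN` for rational upper-triangular `b` (★ F5-p).
[cite: MoeglinWaldspurger1995, II.1.7] [cite: WeilBNT1967, Ch. IV §4 Thm. 5] -/
theorem innerSectionOrbit_borelU_mul [MeasurableSpace (AdeleRing (𝓞 L) L)] [BorelSpace (AdeleRing (𝓞 L) L)] [SecondCountableTopology (AdeleRing (𝓞 L) L)]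
    [MeasurableSpace ↥(klingenUnipA Ψ)] [BorelSpace ↥(klingenUnipA Ψ)] [LocallyCompactSpace ↥(klingenUnipA Ψ)] [SecondCountableTopology ↥(klingenUnipA Ψ)]
    (νN : Measure ↥(klingenUnipA Ψ)) [νN.IsHaarMeasure]
    (Y : AddSubgroup (AdeleRing (𝓞 L) L)) (hY : ∀ y, y ∈ Y ↔ conjAdele (Fp L) L (IsCMField.complexConj L) y = -y)
    (μZ : Measure (AdeleRing (𝓞 L) L)) (μY : Measure ↥Y) (μT : Measure (AdeleRing (𝓞 L) L)) [SFinite μZ] [SFinite μY] [SFinite μT]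
    [μZ.IsAddHaarMeasure] [μY.IsAddHaarMeasure] [μT.IsAddHaarMeasure]
    (Γ₁ : Subgroup ↥(klingenUnipA Ψ))
    (hΓ₁ : ∀ u : ↥(klingenUnipA Ψ), u ∈ Γ₁ ↔ (u : HA L e dV hdV dW hdW) ∈ ratH L e dV hdV dW hdW ∧
      IsSiegelDelta L e dV hdV dW hdW (Ψ (UnitaryGroup.toAdelic (Fp L) L (IsCMField.complexConj L) (2 + 2) ((StdForm.antidiagonal (2 + 2)).over L) (weylXi L ((IsCMField.complexConj L : L ≃ₐ[Fp L] L) : L →+* L))) * (u : HA L e dV hdV dW hdW) * (Ψ (UnitaryGroup.toAdelic (Fp L) L (IsCMField.complexConj L) (2 + 2) ((StdForm.antidiagonal (2 + 2)).over L) (weylXi L ((IsCMField.complexConj L : L ≃ₐ[Fp L] L) : L →+* L))))⁻¹))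
    {β₁ : ↥(klingenUnipA Ψ) → ℝ≥0∞} (hβ₁ : IsCoveringWeight ↥Γ₁ β₁)
    {β₀ : AdeleRing (𝓞 L) L → ℝ≥0∞} (hβ₀m : Measurable β₀) (hβ₀ : ∀ z, ∑' l : ↥((algebraMap L (AdeleRing (𝓞 L) L)).toAddMonoidHom.range), β₀ ((l : AdeleRing (𝓞 L) L) + z) = 1)
    (hβ₀fin : ∫⁻ z, β₀ z ∂μZ ≠ ∞)
    {χ : HeckeCharacter L} {s : ℂ} {f : HA L e dV hdV dW hdW → ℂ} (hf : IsSiegelDeltaSection L e dV hdV dW hdW χ s f) (hfc : Continuous f)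
    (hint : ∀ x : HA L e dV hdV dW hdW, Integrable (fun u : ↥(klingenUnipA Ψ) => (β₁ u).toReal • f (Ψ (jAdelic L 4 (weylXi (AdeleRing (𝓞 L) L) (conjAdele (Fp L) L (IsCMField.complexConj L)))) * (u : HA L e dV hdV dW hdW) * x)) νN)
    (bL : unitaryGroupOfForm ((IsCMField.complexConj L : L ≃ₐ[Fp L] L) : L →+* L) ((StdForm.antidiagonal 2).over L)) (hbL : bL ∈ borelU ((IsCMField.complexConj L : L ≃ₐ[Fp L] L) : L →+* L) ((StdForm.antidiagonal 2).over L)) (x : HA L e dV hdV dW hdW) :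
    (∫ u, (β₁ u).toReal • f (Ψ (jAdelic L 4 (weylXi (AdeleRing (𝓞 L) L) (conjAdele (Fp L) L (IsCMField.complexConj L)))) * (u : HA L e dV hdV dW hdW) * (Ψ (UnitaryGroup.toAdelic (Fp L) L (IsCMField.complexConj L) (2 + 2) ((StdForm.antidiagonal (2 + 2)).over L) (klingenLevi L ((IsCMField.complexConj L : L ≃ₐ[Fp L] L) : L →+* L) (complexConj_ringHom_apply_apply L) 1 bL)) * x)) ∂νN) = (∫ u, (β₁ u).toReal • f (Ψ (jAdelic L 4 (weylXi (AdeleRing (𝓞 L) L) (conjAdele (Fp L) L (IsCMField.complexConj L)))) * (u : HA L e dV hdV dW hdW) * (x)) ∂νN) := by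
  obtain ⟨C, _, hC⟩ := exists_const_innerSectionOrbit_eq hΨ ha hSA hSAi hXY hYX hΨP νN Y hY μZ μY μT Γ₁ hΓ₁ hβ₁ hβ₀m hβ₀ hβ₀fin hf hfc hint
  rw [hC, hC, klingenInner_borelU_mul hΨ ha hSA hSAi hXY hYX hΨP Y hY μY μT hf hfc bL hbL x]

include hΨ ha hSA hSAi hΨP hXY hYX in
/-- **(Q2) F5-q — TERM 2 OF `E_Q` IS AUTOMORPHIC ON THE KLINGEN LEVI.**  With the section `F_h(y) = ∫ β₁ • f(Ψ(toAdelic ξ)·u·Ψ(jAdelic m_Q^𝔸(1, j₂⁻¹y))·h) dνN` of ★ F5-g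
`tsum_cellXi_eq_eisensteinSeriesU`: `eisensteinSeriesU F_h (toAdelic γ · g₂) = eisensteinSeriesU F_h g₂` for every `γ ∈ U(J₂)(L⁺)` and `g₂ ∈ U(J₂)(𝔸_{L⁺})`
(E1's `hf` from `innerSectionOrbit_borelU_mul`, then ★ E1 `eisensteinSeriesU_rational_mul`). [cite: MoeglinWaldspurger1995, II.1.5, II.1.7] [cite: Garrett2018, §3.10] -/
theorem eisensteinSeriesU_innerSection_rational_mul [MeasurableSpace (AdeleRing (𝓞 L) L)] [BorelSpace (AdeleRing (𝓞 L) L)] [SecondCountableTopology (AdeleRing (𝓞 L) L)]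
    [MeasurableSpace ↥(klingenUnipA Ψ)] [BorelSpace ↥(klingenUnipA Ψ)] [LocallyCompactSpace ↥(klingenUnipA Ψ)] [SecondCountableTopology ↥(klingenUnipA Ψ)]
    (νN : Measure ↥(klingenUnipA Ψ)) [νN.IsHaarMeasure]
    (Y : AddSubgroup (AdeleRing (𝓞 L) L)) (hY : ∀ y, y ∈ Y ↔ conjAdele (Fp L) L (IsCMField.complexConj L) y = -y)
    (μZ : Measure (AdeleRing (𝓞 L) L)) (μY : Measure ↥Y) (μT : Measure (AdeleRing (𝓞 L) L)) [SFinite μZ] [SFinite μY] [SFinite μT]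
    [μZ.IsAddHaarMeasure] [μY.IsAddHaarMeasure] [μT.IsAddHaarMeasure]
    (Γ₁ : Subgroup ↥(klingenUnipA Ψ))
    (hΓ₁ : ∀ u : ↥(klingenUnipA Ψ), u ∈ Γ₁ ↔ (u : HA L e dV hdV dW hdW) ∈ ratH L e dV hdV dW hdW ∧
      IsSiegelDelta L e dV hdV dW hdW (Ψ (UnitaryGroup.toAdelic (Fp L) L (IsCMField.complexConj L) (2 + 2) ((StdForm.antidiagonal (2 + 2)).over L) (weylXi L ((IsCMField.complexConj L : L ≃ₐ[Fp L] L) : L →+* L))) * (u : HA L e dV hdV dW hdW) * (Ψ (UnitaryGroup.toAdelic (Fp L) L (IsCMField.complexConj L) (2 + 2) ((StdForm.antidiagonal (2 + 2)).over L) (weylXi L ((IsCMField.complexConj L : L ≃ₐ[Fp L] L) : L →+* L))))⁻¹))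
    {β₁ : ↥(klingenUnipA Ψ) → ℝ≥0∞} (hβ₁ : IsCoveringWeight ↥Γ₁ β₁)
    {β₀ : AdeleRing (𝓞 L) L → ℝ≥0∞} (hβ₀m : Measurable β₀) (hβ₀ : ∀ z, ∑' l : ↥((algebraMap L (AdeleRing (𝓞 L) L)).toAddMonoidHom.range), β₀ ((l : AdeleRing (𝓞 L) L) + z) = 1)
    (hβ₀fin : ∫⁻ z, β₀ z ∂μZ ≠ ∞)
    {χ : HeckeCharacter L} {s : ℂ} {f : HA L e dV hdV dW hdW → ℂ} (hf : IsSiegelDeltaSection L e dV hdV dW hdW χ s f) (hfc : Continuous f)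
    (hint : ∀ x : HA L e dV hdV dW hdW, Integrable (fun u : ↥(klingenUnipA Ψ) => (β₁ u).toReal • f (Ψ (jAdelic L 4 (weylXi (AdeleRing (𝓞 L) L) (conjAdele (Fp L) L (IsCMField.complexConj L)))) * (u : HA L e dV hdV dW hdW) * x)) νN)
    (h : HA L e dV hdV dW hdW) (γ : unitaryGroupOfForm ((IsCMField.complexConj L : L ≃ₐ[Fp L] L) : L →+* L) ((StdForm.antidiagonal 2).over L)) (g₂ : (quasiSplit (Fp L) L (IsCMField.complexConj L) 2).Adelic) :
    eisensteinSeriesU (fun y : (quasiSplit (Fp L) L (IsCMField.complexConj L) 2).Adelic =>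
        ∫ u, (β₁ u).toReal • f (Ψ (UnitaryGroup.toAdelic (Fp L) L (IsCMField.complexConj L) (2 + 2) ((StdForm.antidiagonal (2 + 2)).over L) (weylXi L ((IsCMField.complexConj L : L ≃ₐ[Fp L] L) : L →+* L))) * (u : HA L e dV hdV dW hdW) *
          (Ψ (jAdelic L 4 (klingenLevi (AdeleRing (𝓞 L) L) (conjAdele (Fp L) L (IsCMField.complexConj L)) (conjAdele_conjAdele' L) 1 ((jAdelic L 2).symm y))) * h)) ∂νN)
        ((quasiSplit (Fp L) L (IsCMField.complexConj L) 2).toAdelic γ * g₂) =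
      eisensteinSeriesU (fun y : (quasiSplit (Fp L) L (IsCMField.complexConj L) 2).Adelic =>
        ∫ u, (β₁ u).toReal • f (Ψ (UnitaryGroup.toAdelic (Fp L) L (IsCMField.complexConj L) (2 + 2) ((StdForm.antidiagonal (2 + 2)).over L) (weylXi L ((IsCMField.complexConj L : L ≃ₐ[Fp L] L) : L →+* L))) * (u : HA L e dV hdV dW hdW) *
          (Ψ (jAdelic L 4 (klingenLevi (AdeleRing (𝓞 L) L) (conjAdele (Fp L) L (IsCMField.complexConj L)) (conjAdele_conjAdele' L) 1 ((jAdelic L 2).symm y))) * h)) ∂νN) g₂ := by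
  refine eisensteinSeriesU_rational_mul (fun bL hbL y => ?_) γ g₂
  have hq : (quasiSplit (Fp L) L (IsCMField.complexConj L) 2).toAdelic bL = UnitaryGroup.toAdelic (Fp L) L (IsCMField.complexConj L) 2 ((StdForm.antidiagonal 2).over L) bL := rfl
  simp only [hq, map_mul (jAdelic L 2).symm, klingenLevi_one_mul, map_mul, jAdelic_klingenLevi_one_symm_toAdelic, toAdelic_weylXi_eq_jAdelic, mul_assoc]
  have h2 := innerSectionOrbit_borelU_mul hΨ ha hSA hSAi hXY hYX hΨP νN Y hY μZ μY μT Γ₁ hΓ₁ hβ₁ hβ₀m hβ₀ hβ₀fin hf hfc hint bL hbL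
    (Ψ (jAdelic L 4 (klingenLevi (AdeleRing (𝓞 L) L) (conjAdele (Fp L) L (IsCMField.complexConj L)) (conjAdele_conjAdele' L) 1 ((jAdelic L 2).symm y))) * h)
  simp only [mul_assoc] at h2
  exact h2

end Transport

end Summit.HodgeConjecture.HodgeConjecture.Cruxes.HLiu418.K2LiuKlingenInnerSectionAutomorphy

end
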